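import Literature.NumberTheory.EllipticCurves.ComplexMultiplicationBurungaleFlachProofs
import Literature.NumberTheory.EllipticCurves.ComplexPeriod
import Literature.NumberTheory.EllipticCurves.GlobalMinimalModelProofs
import Literature.NumberTheory.QuadraticFields.ClassNumberOne
import Mathlib.RingTheory.AdjoinRoot
import Mathlib.Algebra.Polynomial.SpecificDegree
import Mathlib.NumberTheory.NumberField.Basic
import HarnessLib

/-!
# bsd.S28 (Burungale–Flach), level 2 of the decomposition: BSD over the CM field `K` and the
descent `K → ℚ`

Second sibling proof file of `Literature.NumberTheory.EllipticCurves.ComplexMultiplication` for the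
named fact `Literature.NumberTheory.EllipticCurves.bsdTriple_of_j_mem_maximalCMJInvariants_of_L_one_ne_zero` (**bsd.S28**, the
full Birch–Swinnerton-Dyer statement for `E/ℚ` with CM by a maximal order `𝓞_K` and
`L(E,1) ≠ 0`; Burungale–Flach, Camb. J. Math. 12 (2024)). Level 1
(`ComplexMultiplicationBurungaleFlachProofs.lean`) reduced the target, sorry-free, to the printed
leaf `Literature.NumberTheory.EllipticCurves.BurungaleFlach2024_bsd_rat` = Burungale–Flach **Corollary 2** ("BSD for `E/F⁺`") at
`F⁺ = ℚ`. This file performs the next step *of the printed proof*: Corollary 2 is deduced in the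
paper (p. 4) from **Corollary 1** ("BSD for `E/F`", here `F = K`, the CM field) by Weil
restriction of scalars and isogeny invariance (Milne 1972, Thm. 1, Thm. 3 and its Corollary).
Accordingly we vendor, as named facts with precise cites,

* `BurungaleFlach2024_bsd_cmField` — **Corollary 1 at `F = K`** for the base change `E_K` of a CM
  curve `E/ℚ` with `L(E/ℚ,1) ≠ 0` (the hypotheses of Theorem 1.1 for `E_K/K` being exactly what
  the authors certify on p. 4: *"Any CM elliptic curve `E/ℚ` with `L(E/ℚ,1) ≠ 0` satisfies the
  assumptions of Corollary 2"*, which include those of Theorem 1.1 = those of Corollary 1):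
  `E(K)` and `Ш(E/K)` are finite and `L(E/K,1)/Ω(E) = |Ш(E/K)| / |E(K)|² · ∏_v |Φ_v|`, transcribed
  on a globally minimal model `W'` of `E_K` with the BSD period `WeierstrassCurve.bsdPeriod`
  over `K` (`ComplexPeriod.lean`; for `F = K` it is `2 covol(Λ_ω)/|d_K|^{1/2}`, Burungale–Flach
  Remark 2) and `|Φ_v| = c_v` (Lemma "localvolume", Cor. 5);
* `BurungaleFlach2024_bsd_rat_of_bsd_cmField` — **the proof of Corollary 2** (p. 4) at
  `F⁺ = ℚ`: under the same hypotheses, BSD for `E_K/K` in the above sense implies BSD for `E/ℚ`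
  in the sense of the leaf (`Res_{K/ℚ} E_K ∼ E × E_ε ∼ E × E` by Milne 1972 Thm. 3,
  `Ш(E/K) ≅ Ш(A/ℚ)`, `E(K) ≅ A(ℚ)` and BSD(`E/K`) ⇔ BSD(`A/ℚ`) by Milne 1972 Thm. 1, isogeny
  invariance of BSD, and "all terms in the BSD formula for `(E × E)/F⁺` are the squares of the
  corresponding terms for `E/F⁺`… taking square roots", Milne 1972, Cor. to Thm. 3);
and we *prove* `isPrincipalIdealRing_of_isCMFieldOfJ` — the nine CM fields `ℚ(√-d)`,
`d = 3, 1, 7, 2, 11, 19, 43, 67, 163`, have class number one (Gauss; Silverman, *Advanced Topics*,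
Example II.6.2.1 and App. A §3; Burungale–Flach p. 4: "In this case the class number of `K` is
`1`"), from `Literature.NumberTheory.QuadraticFields.Quadratic.isPrincipalIdealRing_of_sq_eq_intCast`
(`Literature.NumberTheory.QuadraticFields.ClassNumberOne`: Minkowski bound and inert small primes,
without computing `𝓞_K`); it is needed only to produce a globally minimal model of `E_K` over `𝓞_K`
through the *discharged* tree fact `WeierstrassCurve.hasGlobalMinimalModel_of_isPrincipalIdealRing`
(`…_holds`, `GlobalMinimalModelProofs.lean`; Silverman AEC VIII.8.3) —

together with the elementary, proved, bookkeeping: the table `cmFieldDiscr` (`j ↦ d_K`, App. A §3),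
the predicate `IsCMFieldOfJ K j` ("`K ≅ ℚ(√d_K)`": `[K:ℚ] = 2` and `d_K` is a square in `K`), the
construction of such a `K` (`exists_isCMFieldOfJ`, as `ℚ[X]/(X² − d_K)`), and the assemblies

* `bsdPeriod_eq_of_isCMFieldOfJ` : over the CM field the BSD period *is* `2 covol(Λ_ω)/|d_K|^{1/2}`
  (one complex place), the dictionary used for `Ω(E)`;
* `BurungaleFlach2024_bsd_rat_of_bsd_cmField_of_bsd_rat` : the descent fact is implied by the
  leaf (it is not stronger than Corollary 2 over `ℚ`);
* `BurungaleFlach2024_bsd_rat_of_level2` : the two level-2 facts ⇒ the leaf;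
* `bsdTriple_of_j_mem_maximalCMJInvariants_of_L_one_ne_zero_of_level2` : … ⇒ bsd.S28.

So after this file bsd.S28 rests, sorry-free, on exactly two printed statements: Corollary 1
over `K` (the Iwasawa-theoretic heart: Thm. 1.1 = Johnson-Leung–Kings' two-variable main
conjecture + Kato's explicit reciprocity law + the ETNC descent, and Shimura's
`L(E/K,s) = L(ψ,s)L(ψ̄,s)`) and the Weil-restriction descent (Milne 1972); class number one of the
nine fields and global minimal models over a PID are proved in the tree. The next level (Thm. 1.1
itself) needs the Hecke character `ψ_{E/K}`, `L(ψ̄,s)` and `𝓞_K`-order ideals, none of which is in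
the tree or in Mathlib.

## Design and faithfulness notes

* Everything is stated for `W : WeierstrassCurve ℚ` with `W.j ∈ maximalCMJInvariants` (CM by
  `𝓞_K` over `ℚ̄`, the convention of the parent file) and an abstract number field `K` with
  `IsCMFieldOfJ K W.j`; the curve over `K` is any globally minimal `W'` which is `K`-isomorphic to
  the base change (`∃ C, C • W.baseChange K = W'`). All BSD invariants of `W'` are the tree's,
  over a general number field: `entireLFunction` (Mathlib's `LFunction` over `K`, local minimal
  models), `bsdPeriod` (new, `ComplexPeriod.lean`), `shaOrder`/`ShaFinite` (`Sha.lean`),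
  `tamagawaProduct` (`Tamagawa.lean`), `Nat.card` of `W'.toAffine.Point`.
* `K : Type` (universe `0`) inside the facts, as in `Literature.BSD.ShaFiniteConjectureNF`; the field
  built in `exists_isCMFieldOfJ` lives there.
* The descent fact is an implication between the two printed BSD statements under the printed
  standing hypotheses (including `L(E/ℚ,1) ≠ 0`, which only weakens it); its conclusion is
  literally the body of the leaf, so the assembly is bookkeeping. The sign implicit in "taking
  square roots" is part of what the source asserts (Cor. 2 is an equality), not an addition.
* Vacuity: the hypotheses are jointly satisfiable — `27a1`, `32a2`, `49a1` have
  `j = 0, 1728, -3375`, `L(E,1) ≈ 0.589, 0.656, 0.967 ≠ 0` (LMFDB), `K = ℚ(√-3), ℚ(i), ℚ(√-7)`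
  exist by `exists_isCMFieldOfJ`, and globally minimal `W'` exist by VIII.8.3 since `h_K = 1`.

## References

* A. Burungale, M. Flach, *The conjecture of Birch and Swinnerton-Dyer for certain elliptic curves
  with complex multiplication*, Camb. J. Math. 12 (2024) (arXiv:2206.09874): Thm. 1.1 and Cor. 1
  (p. 3), the two sentences on p. 4 ("Any elliptic curve `E/K` with CM by `𝓞_K` for which
  `L(E/K,1) ≠ 0` satisfies the assumptions of Theorem 1.1 and Corollary 1. In this case the class
  number of `K` is `1`." and "Any CM elliptic curve `E/ℚ` with `L(E/ℚ,1) ≠ 0` satisfies the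
  assumptions of Corollary 2."), Remark 2 (the period), Cor. 2 and its proof (p. 4), Cor. 5 and
  Lemma "localvolume" (`Φ_v = E(F_v)/E⁰(F_v)`). [BurungaleFlach2024]
* J. S. Milne, *On the arithmetic of abelian varieties*, Invent. Math. 17 (1972), 177–190, Thm. 1
  (BSD is invariant under Weil restriction), Thm. 3 and its Corollary — cited through
  [BurungaleFlach2024] (the held copy has no text layer). [Milne1972ArithmeticAV]
* J. H. Silverman, *Advanced Topics in the Arithmetic of Elliptic Curves*, GTM 151 (1994),
  Example II.6.2.1 (the nine imaginary quadratic fields of class number one) and Appendix A §3,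
  first table (`j`-invariants of the orders of class number one, rows `f = 1`). [SilvermanATAEC1994]
* J. H. Silverman, *The Arithmetic of Elliptic Curves*, 2nd ed., VIII.8.2–8.3 (global minimal
  models over a PID). [SilvermanAEC2009]
-/

noncomputable section

open scoped Classical

open WeierstrassCurve Polynomial NumberField

namespace Literature.NumberTheory.EllipticCurves

/-! ### The CM field of a maximal-order CM `j`-invariant -/

/-- The fundamental discriminant `d_K` of the CM field `K = End(E) ⊗ ℚ` of an elliptic curve over
`ℚ` with `j(E) = j ∈ maximalCMJInvariants` (CM by the maximal order `𝓞_K`):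
`0 ↦ -3`, `1728 ↦ -4`, `-3375 ↦ -7`, `8000 ↦ -8`, `-32768 ↦ -11`, `-884736 ↦ -19`,
`-884736000 ↦ -43`, `-147197952000 ↦ -67`, `-262537412640768000 ↦ -163`
(so `K = ℚ(√-3), ℚ(i), ℚ(√-7), ℚ(√-2), ℚ(√-11), ℚ(√-19), ℚ(√-43), ℚ(√-67), ℚ(√-163)`), read off
the rows `f = 1` of the first table of Silverman, *Advanced Topics*, App. A §3
(`j = 0, 2⁶3³, -3³5³, 2⁶5³, -2¹⁵, -2¹⁵3³, -2¹⁸3³5³, -2¹⁵3³5³11³, -2¹⁸3³5³23³29³`). Junk value `0`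
off `maximalCMJInvariants`. [cite: SilvermanATAEC1994, App. A §3 (first table)] -/
def cmFieldDiscr (j : ℚ) : ℤ :=
  if j = 0 then -3 else if j = 1728 then -4 else if j = -3375 then -7 else if j = 8000 then -8
  else if j = -32768 then -11 else if j = -884736 then -19 else if j = -884736000 then -43
  else if j = -147197952000 then -67 else if j = -262537412640768000 then -163 else 0

/-- The nine values of `cmFieldDiscr` on `maximalCMJInvariants` are the nine negative
fundamental discriminants of class number one. Silverman, *Advanced Topics*, App. A §3.
[cite: SilvermanATAEC1994, App. A §3 (first table)] -/
theorem cmFieldDiscr_mem {j : ℚ} (hj : j ∈ maximalCMJInvariants) :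
    cmFieldDiscr j ∈ ({-3, -4, -7, -8, -11, -19, -43, -67, -163} : Finset ℤ) := by
  simp only [maximalCMJInvariants, Finset.mem_insert, Finset.mem_singleton] at hj
  rcases hj with rfl | rfl | rfl | rfl | rfl | rfl | rfl | rfl | rfl <;>
    norm_num [cmFieldDiscr]

/-- The CM discriminant of a maximal-order CM `j`-invariant is negative (the CM field is imaginary
quadratic). Silverman, *Advanced Topics*, App. A §3. [folklore] -/
theorem cmFieldDiscr_neg {j : ℚ} (hj : j ∈ maximalCMJInvariants) : cmFieldDiscr j < 0 := by
  have h := cmFieldDiscr_mem hj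
  simp only [Finset.mem_insert, Finset.mem_singleton] at h
  rcases h with h | h | h | h | h | h | h | h | h <;> rw [h] <;> norm_num

/-- `IsCMFieldOfJ K j`: the number field `K` *is the CM field* of the curves over `ℚ` with
`j`-invariant `j ∈ maximalCMJInvariants`, i.e. `K ≅ ℚ(√d_K)` with `d_K = cmFieldDiscr j`:
`[K : ℚ] = 2` and `d_K` is a square in `K` (since `d_K < 0` is not a square in `ℚ`, a square root
`θ` of `d_K` in a quadratic `K` generates it, `K = ℚ(θ) ≅ ℚ[X]/(X² − d_K)`). For such `K` the
base change `E_K` has all its endomorphisms defined over `K` ("CM by `𝓞_K`" with `F = K` in the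
notation of Burungale–Flach, Thm. 1.1). Silverman, *Advanced Topics*, II.2.2(b) and App. A §3.
[cite: SilvermanATAEC1994, App. A §3 (first table)] -/
def IsCMFieldOfJ (K : Type*) [Field K] [CharZero K] (j : ℚ) : Prop :=
  Module.finrank ℚ K = 2 ∧ ∃ θ : K, θ ^ 2 = (cmFieldDiscr j : K)

/-- **Existence of the CM field** as a number field (in `Type`): for `j ∈ maximalCMJInvariants`,
`K = ℚ[X]/(X² − d_K)` is a number field with `IsCMFieldOfJ K j` (`X² − d_K` is irreducible over
`ℚ` because `d_K < 0` has no rational square root). [folklore] -/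
theorem exists_isCMFieldOfJ {j : ℚ} (hj : j ∈ maximalCMJInvariants) :
    ∃ (K : Type) (_ : Field K) (_ : NumberField K), IsCMFieldOfJ K j := by
  set d : ℤ := cmFieldDiscr j with hd_def
  have hd : d < 0 := cmFieldDiscr_neg hj
  let f : ℚ[X] := X ^ 2 - C (d : ℚ)
  have hf_monic : f.Monic := monic_X_pow_sub_C _ two_ne_zero
  have hf_deg : f.natDegree = 2 := natDegree_X_pow_sub_C
  have hf_ne : f ≠ 0 := hf_monic.ne_zero
  have hroots : f.roots = 0 := by
    refine Multiset.eq_zero_of_forall_notMem fun x hx => ?_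
    rw [mem_roots hf_ne, IsRoot.def, eval_sub, eval_pow, eval_X, eval_C, sub_eq_zero] at hx
    have hx0 : (0 : ℚ) ≤ x ^ 2 := sq_nonneg x
    have hd' : ((d : ℚ)) < 0 := by exact_mod_cast hd
    linarith
  have hirr : Irreducible f := by
    rw [hf_monic.irreducible_iff_roots_eq_zero_of_degree_le_three (by omega) (by omega)]
    exact hroots
  haveI : Fact (Irreducible f) := ⟨hirr⟩
  haveI hfin : Module.Finite ℚ (AdjoinRoot f) := (AdjoinRoot.powerBasis hf_ne).finite
  haveI : CharZero (AdjoinRoot f) := charZero_of_injective_algebraMap (algebraMap ℚ _).injective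
  haveI : NumberField (AdjoinRoot f) := NumberField.mk
  refine ⟨AdjoinRoot f, inferInstance, inferInstance, ?_, AdjoinRoot.root f, ?_⟩
  · rw [(AdjoinRoot.powerBasis hf_ne).finrank, AdjoinRoot.powerBasis_dim, hf_deg]
  · have h := AdjoinRoot.eval₂_root f
    rw [eval₂_sub, eval₂_X_pow, eval₂_C, sub_eq_zero] at h
    rw [h, ← hd_def]
    simp

/-- The CM field is imaginary quadratic: a field `K` with `IsCMFieldOfJ K j` has no real place
(a real embedding would send a square root of `d_K < 0` to a real number of negative square).
[folklore] -/
theorem IsCMFieldOfJ.isTotallyComplex {K : Type*} [Field K] [NumberField K] {j : ℚ}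
    (hj : j ∈ maximalCMJInvariants) (hK : IsCMFieldOfJ K j) : IsTotallyComplex K := by
  refine ⟨fun w => ?_⟩
  rw [← InfinitePlace.not_isReal_iff_isComplex]
  intro hw
  obtain ⟨θ, hθ⟩ := hK.2
  have hd : ((cmFieldDiscr j : ℤ) : ℝ) < 0 := by exact_mod_cast cmFieldDiscr_neg hj
  have h := congrArg (InfinitePlace.embedding_of_isReal hw) hθ
  rw [map_pow, map_intCast] at h
  have h0 : 0 ≤ (InfinitePlace.embedding_of_isReal hw θ) ^ 2 := sq_nonneg _
  rw [h] at h0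
  exact absurd hd (not_lt.mpr h0)

/-- A field `K` with `IsCMFieldOfJ K j` has exactly one infinite place (which is complex).
[folklore] -/
theorem IsCMFieldOfJ.card_infinitePlace {K : Type*} [Field K] [NumberField K] {j : ℚ}
    (hj : j ∈ maximalCMJInvariants) (hK : IsCMFieldOfJ K j) :
    Fintype.card (InfinitePlace K) = 1 := by
  haveI := hK.isTotallyComplex hj
  exact card_infinitePlace_eq_one_of_finrank_eq_two hK.1

/-- **The period dictionary over the CM field, made explicit.** For `K` with `IsCMFieldOfJ K j`
and any Weierstrass model `W'` over `K`, the BSD period of `ComplexPeriod.lean` is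
`Ω(E) = ∫_{E(ℂ)}|ω ∧ ω̄| / |d_K|^{1/2} = 2 covol(Λ_ω) / |d_K|^{1/2}` along (either embedding of)
the unique complex place — Burungale–Flach's `Ω(E)` for `F = K` (Remark 2: one complex place,
Haar measure `2dx ∧ dy`, `I_ω = 1` on a globally minimal model).
[cite: BurungaleFlach2024, Remark 2 (arXiv p. 4)] -/
theorem bsdPeriod_eq_of_isCMFieldOfJ {K : Type*} [Field K] [NumberField K] {j : ℚ}
    (hj : j ∈ maximalCMJInvariants) (hK : IsCMFieldOfJ K j) (W' : WeierstrassCurve K)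
    (w : InfinitePlace K) :
    W'.bsdPeriod = (W'.map w.embedding).complexPeriod / Real.sqrt |(discr K : ℝ)| := by
  haveI := hK.isTotallyComplex hj
  rw [W'.bsdPeriod_eq_of_card_eq_one (hK.card_infinitePlace hj) w,
    W'.placePeriod_of_isTotallyComplex]

/-! ### Level-2 named facts -/

/-- **Class number one of the nine CM fields** (needed only to have global minimal models over
`𝓞_K`). The imaginary quadratic fields `ℚ(√-1), ℚ(√-2), ℚ(√-3), ℚ(√-7), ℚ(√-11), ℚ(√-19),
ℚ(√-43), ℚ(√-67), ℚ(√-163)` — the fields `K` with `IsCMFieldOfJ K j` for the nine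
`j ∈ maximalCMJInvariants` — have class number `1`, i.e. `𝓞 K` is a principal ideal ring
(Gauss; the converse, that these are the only ones, is Heegner–Baker–Stark and is *not* asserted).
Silverman, *Advanced Topics*, Example II.6.2.1 ("there are only nine quadratic imaginary fields of
class number 1 … These fields are …") and App. A §3; Burungale–Flach p. 4 ("In this case the class
number of `K` is `1`"). Proved in `Literature.NumberTheory.QuadraticFields.ClassNumberOne`
(`Literature.NumberTheory.QuadraticFields.Quadratic.isPrincipalIdealRing_of_sq_eq_intCast`: Minkowski's bound `(2/π)√|d_K|` and
inertness of the primes below it, Marcus, *Number Fields*, Ch. 5, Cor. 2 of Thm. 37 and Exercise 9).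
[cite: SilvermanATAEC1994, Example II.6.2.1 and App. A §3] -/
theorem isPrincipalIdealRing_of_isCMFieldOfJ (K : Type*) [Field K] [NumberField K] {j : ℚ}
    (hj : j ∈ maximalCMJInvariants) (hK : IsCMFieldOfJ K j) : IsPrincipalIdealRing (𝓞 K) := by
  obtain ⟨θ, hθ⟩ := hK.2
  exact Literature.NumberTheory.QuadraticFields.Quadratic.isPrincipalIdealRing_of_sq_eq_intCast hK.1 hθ (cmFieldDiscr_mem hj)

/-- **Burungale–Flach 2024, Corollary 1 (BSD for `E/F`) at `F = K`, for the base change of a CM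
curve over `ℚ`, as printed.** Corollary 1: under the assumptions of Theorem 1.1 (`E/F` with CM
by `𝓞_K`, `K ⊆ F`, `F(E_tors)/K` abelian, `L(ψ̄,1) ≠ 0` for the Hecke character `ψ` of `E/F`)
the groups `E(F)` and `Ш(E/F)` are finite and `L(E/F,1)/Ω(E) = |Ш(E/F)| / |E(F)|² · ∏_v |Φ_v|`.
Here `F = K` and `E = E_K` is the base change of `E/ℚ` with `j(E) ∈ maximalCMJInvariants` (CM by
`𝓞_K`) and `L(E/ℚ,1) ≠ 0`, for which the authors state (p. 4, after Cor. 2): *"Any CM elliptic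
curve `E/ℚ` with `L(E/ℚ,1) ≠ 0` satisfies the assumptions of Corollary 2"* — and the assumptions
of Corollary 2 contain those of Theorem 1.1 for `E_K/K`, i.e. those of Corollary 1 (also p. 4,
first sentence: any `E/K` with CM by `𝓞_K` and `L(E/K,1) ≠ 0` satisfies them, and then
`h_K = 1`).

Dictionary (for `K` a number field with `IsCMFieldOfJ K j(E)`, i.e. `K ≅` the CM field, and
`W'` a globally minimal Weierstrass model over `K` of `E_K`, `∃ C, C • W.baseChange K = W'`):
`L(E/K,1) = W'.entireLFunction 1` (Mathlib's `L`-function over `K`, Euler product over the primes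
of `𝓞_K` on local minimal models; entire by Deuring–Hecke); `Ω(E) = W'.bsdPeriod`, the period of
Remark 2 / eq. (periodnorm) — for `F = K` one complex place and `I_ω = 1` on a globally minimal
model, `Ω(E) = vol_{2dx∧dy}(E(ℂ))/|d_K|^{1/2} = 2 covol(Λ_ω)/|d_K|^{1/2}`
(`WeierstrassCurve.bsdPeriod_eq_of_card_eq_one`); `|Ш(E/K)| = W'.shaOrder`,
`|E(K)| = Nat.card` of `W'.toAffine.Point`, and `|Φ_v| = [E(K_v) : E⁰(K_v)] = c_v` (Lemma
"localvolume" and Cor. 5), so `∏_v |Φ_v| = W'.tamagawaProduct`. The identity is stated in `ℂ`.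
[cite: BurungaleFlach2024, Cor. 1 (arXiv p. 3) with p. 4 (the two sentences quoted) and Remark 2] -/
def BurungaleFlach2024_bsd_cmField : Prop :=
  ∀ (W : WeierstrassCurve ℚ) [W.IsElliptic], W.j ∈ maximalCMJInvariants →
    W.entireLFunction 1 ≠ 0 →
    ∀ (K : Type) [Field K] [NumberField K], IsCMFieldOfJ K W.j →
      ∀ (W' : WeierstrassCurve K) [W'.IsElliptic] [W'.IsGloballyMinimal],
        (∃ C : VariableChange K, C • W.baseChange K = W') →
          Finite W'.toAffine.Point ∧ W'.ShaFinite ∧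
            W'.entireLFunction 1 / (W'.bsdPeriod : ℂ) =
              (W'.shaOrder : ℂ) / (Nat.card W'.toAffine.Point : ℂ) ^ 2 * (W'.tamagawaProduct : ℂ)

/-- **Burungale–Flach 2024, proof of Corollary 2 (the descent `F → F⁺` by Weil restriction), at
`F⁺ = ℚ`, `F = K`, as printed.** For `E/ℚ` with `j(E) ∈ maximalCMJInvariants` and
`L(E/ℚ,1) ≠ 0` (the standing assumptions, p. 4) and `K` its CM field: *if* BSD holds for `E_K/K`
in the sense of Corollary 1 (`E(K)`, `Ш(E/K)` finite and
`L(E/K,1)/Ω(E_K) = |Ш(E/K)|/|E(K)|² · ∏_v |Φ_v|`, on a globally minimal model `W'` of `E_K`, as in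
`BurungaleFlach2024_bsd_cmField`), *then* BSD holds for `E/ℚ` in the sense of Corollary 2
(`E(ℚ)`, `Ш(E/ℚ)` finite and `L(E/ℚ,1)/Ω(E⁺) = |Ш(E/ℚ)|/|E(ℚ)|² · ∏_p |Φ⁺_p|` on the globally
minimal model `W`, literally the body of `BurungaleFlach2024_bsd_rat`). The printed proof: for
the quadratic extension `F/F⁺` there is an isogeny of abelian surfaces
`A := Res^F_{F⁺}(E/F) ∼ E × E_ε` over `F⁺`, `E_ε` the twist by the character of `F/F⁺`, and in
the CM case `E_ε ∼ E` (Milne 1972, Thm. 3), so `A ∼ E × E`; `Ш(E/F) ≅ Ш(A/F⁺)`, `E(F) ≅ A(F⁺)`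
and the BSD formula for `E/F` is equivalent to that for `A/F⁺` (Milne 1972, Thm. 1); by isogeny
invariance of BSD one gets the formula for `(E × E)/F⁺` (and finiteness of `Ш` and of the
Mordell–Weil group), all of whose terms are the squares of those for `E/F⁺`, "and we deduce the
BSD formula for `E/F⁺` by taking square roots (see also Milne 1972, Cor. to Thm. 3, for this
entire argument)". Dictionary as in `BurungaleFlach2024_bsd_cmField` (over `K`) and
`BurungaleFlach2024_bsd_rat` (over `ℚ`: `Ω(E⁺) = W.realPeriodRat`, `|Φ⁺_p| = c_p`).
[cite: BurungaleFlach2024, proof of Cor. 2 (arXiv p. 4)] [cite: Milne1972ArithmeticAV, Thm. 1, Thm. 3 and Corollary (through BurungaleFlach2024)] -/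
def BurungaleFlach2024_bsd_rat_of_bsd_cmField : Prop :=
  ∀ (W : WeierstrassCurve ℚ) [W.IsElliptic] [W.IsGloballyMinimal], W.j ∈ maximalCMJInvariants →
    W.entireLFunction 1 ≠ 0 →
    ∀ (K : Type) [Field K] [NumberField K], IsCMFieldOfJ K W.j →
      ∀ (W' : WeierstrassCurve K) [W'.IsElliptic] [W'.IsGloballyMinimal],
        (∃ C : VariableChange K, C • W.baseChange K = W') →
          (Finite W'.toAffine.Point ∧ W'.ShaFinite ∧
            W'.entireLFunction 1 / (W'.bsdPeriod : ℂ) =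
              (W'.shaOrder : ℂ) / (Nat.card W'.toAffine.Point : ℂ) ^ 2 *
                (W'.tamagawaProduct : ℂ)) →
          Finite W.toAffine.Point ∧ W.ShaFinite ∧
            W.entireLFunction 1 / (W.realPeriodRat : ℂ) =
              (W.shaOrder : ℂ) / (Nat.card W.toAffine.Point : ℂ) ^ 2 * (W.tamagawaProduct : ℂ)

/-- **Faithfulness bookkeeping for the descent fact.** `BurungaleFlach2024_bsd_rat_of_bsd_cmField`
is an implication whose conclusion is the body of the leaf `BurungaleFlach2024_bsd_rat`
(Corollary 2 over `ℚ`), so it is implied by the leaf outright: the vendored descent is *not*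
stronger than Corollary 2 itself (hence, by `BurungaleFlach2024_bsd_rat_of_bsdTriple`, not
stronger than bsd.S28 plus Coates–Wiles). [cite: BurungaleFlach2024, Cor. 2 (arXiv p. 4)] -/
theorem BurungaleFlach2024_bsd_rat_of_bsd_cmField_of_bsd_rat (h : BurungaleFlach2024_bsd_rat) :
    BurungaleFlach2024_bsd_rat_of_bsd_cmField :=
  fun W _ _ hj hL _K _ _ _hK _W' _ _ _ _ => h W hj hL

/-! ### Assembly: level 2 ⇒ the leaf ⇒ bsd.S28 -/

/-- **Level 2 ⇒ Corollary 2 over `ℚ` (the leaf).** From class number one of the CM field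
(`isPrincipalIdealRing_of_isCMFieldOfJ`, proved), the existence of global minimal models over a
PID (Silverman AEC VIII.8.3, the discharged tree fact
`WeierstrassCurve.hasGlobalMinimalModel_of_isPrincipalIdealRing_holds`), Corollary 1 over `K`
(`h₁`) and the Weil-restriction descent (`h₂`): construct `K = ℚ(√d_K)`
(`exists_isCMFieldOfJ`), pick a globally minimal model `W'` of `E_K`, apply `h₁` to it and
descend with `h₂`. Burungale–Flach (2024), proof of Cor. 2.
[cite: BurungaleFlach2024, Cor. 1, Cor. 2 and its proof (arXiv pp. 3–4)] -/
theorem BurungaleFlach2024_bsd_rat_of_level2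
    (h₁ : BurungaleFlach2024_bsd_cmField) (h₂ : BurungaleFlach2024_bsd_rat_of_bsd_cmField) :
    BurungaleFlach2024_bsd_rat := by
  intro W _ _ hj hL
  obtain ⟨K, _, _, hK⟩ := exists_isCMFieldOfJ hj
  haveI : IsPrincipalIdealRing (𝓞 K) := isPrincipalIdealRing_of_isCMFieldOfJ K hj hK
  haveI : (W.baseChange K).IsElliptic := by rw [baseChange]; infer_instance
  obtain ⟨C, hC⟩ := hasGlobalMinimalModel_of_isPrincipalIdealRing_holds (W.baseChange K)
  haveI := hC
  exact h₂ W hj hL K hK (C • W.baseChange K) ⟨C, rfl⟩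
    (h₁ W hj hL K hK (C • W.baseChange K) ⟨C, rfl⟩)

/-- **Level 2 ⇒ bsd.S28.** Composition of `BurungaleFlach2024_bsd_rat_of_level2` with the level-1
assembly `bsdTriple_of_j_mem_maximalCMJInvariants_of_L_one_ne_zero_of_BurungaleFlach2024`
(`ComplexMultiplicationBurungaleFlachProofs.lean`): the target named fact follows from Corollary 1
over the CM field and the descent.
[cite: BurungaleFlach2024, Thm 1.1, Cor. 1, Cor. 2 (arXiv pp. 3–4)] -/
theorem bsdTriple_of_j_mem_maximalCMJInvariants_of_L_one_ne_zero_of_level2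
    (h₁ : BurungaleFlach2024_bsd_cmField) (h₂ : BurungaleFlach2024_bsd_rat_of_bsd_cmField) :
    bsdTriple_of_j_mem_maximalCMJInvariants_of_L_one_ne_zero :=
  bsdTriple_of_j_mem_maximalCMJInvariants_of_L_one_ne_zero_of_BurungaleFlach2024
    (BurungaleFlach2024_bsd_rat_of_level2 h₁ h₂)

end Literature.NumberTheory.EllipticCurves

end
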